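import Summits.QuantumFields.YangMills.Theorems.BalabanUVNodesN15PerCubeGreenTwoGridStepLettersOfReg335
import HarnessLib

/-!
# N15 = NE2, road (c) — PROGRAMME (PC) «[B9] Sect. C FOR THE LANDAU LETTER WITH PER-CUBE GAUGES», (PC-E) THE DIVERGENCE FIT o_B, PART 1 OF 3: THE SECOND-ORDER REGULARITY LETTER —
# «(3.35) ONE ORDER UP» `|∇^η∇^ηA| < Cξ⁻³` ON A CUBE (a MODEL datum `Reg335D2Cube ⊇ Reg335Cube`), THE MIXED SECOND DIFFERENCE OF `exp` IN A BANACH ALGEBRA, AND THE THIRD GROUP LETTER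
# `‖U^u_ν(z+e_κ+e_κ′) − U^u_ν(z+e_κ′) − U^u_ν(z+e_κ) + U^u_ν(z)‖ ≤ η³·c₃` IN THE CUBE GAUGE (dag-n15-c g33, n15-c∕356)

Cell `pub-ymgap`, seat `pub-ymgap-dag-n15-c` (generation g33; R134 (a) seat, strategy s1 «first missing estimate»; HUMAN RULING D-0062; chair R424 venue).
`bears_on: R4∕N15 · K3⁸ SpineGivenEndpointR13SepCoPHV (stmt-QuantumFields-27366)`; filed `--supports stmt-QuantumFields-27366 --as helper` — COUNT-NEUTRAL.
ONE `def` (the MODEL cube datum `Reg335D2Cube`, review lane) + theorems; 0 `sorry`.  Imports BY NAME n15-c∕346 `…PerCubeGreenTwoGridStepLettersOfReg335` (through it dag-n15-w2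
`uN_opLetters_of_gauge335`, `uN_val_gaugeTr_eq`, `bondLetters_of_gauge335`, `val_fluct`, `covD_one_apply'`, `norm_I_eta_smul`; lit-balaban r06 `Reg335Cube`; `Literature.Analysis.Complex`
`norm_exp_sub_exp_le`).  Nothing in the tree is modified, no landed name re-declared.

WHY (the located object of g32, HOME HANDOFF §g32 «LOCATED ANALYSIS»).  The (PC-E-A) chain n15-c∕339–355 is complete MODULO ONE displayed input, the two-grid fit `o_B` of the
DIVERGENCE SUMMAND of the species coefficient (`hB` of n15-c∕344 `sc_hfitC_of_pairing`, carried verbatim by 348∕353∕354∕355): at a fine site `x′` over a cut coarse site `πx′`,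
`|η′⁻²(S′_μ(x′) − S′_μ(x′−e′_μ)) − η⁻²(S_μ(πx′) − S_μ(πx′−e_μ))| ≤ o_B` with `S = Ad` of the transformed bond variables and the coarse field the straight fine holonomy.  With
`S_μ(y) = Π_{t<L^r}S′_μ(σy + te′_μ)` the coarse quantity is an AVERAGE of the fine one over `L^{2r}` pairs of line points plus `O(η·pq)` (double telescoping), so `o_B` small needs the
OSCILLATION of `η′⁻²Δ⁻_μS′_μ` over a coarse cell, i.e. SECOND differences of the transformed bond field: a THIRD letter.  [B9] (3.35) p. 396 prints `|A|, |∇^ηA|` and (3.36) prints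
`|∂^{η*}∂^ηA| < O(1)Mα₀(Lʲη)⁻³` = `d*dA` only, which does NOT control `∂_κ∂_μA_μ` (a pure gauge `A = dφ` with `φ` oscillating at the coarse scale is in the class (3.35)–(3.36) of a
cube while `∂_μA_μ` oscillates by `O(1)` across a coarse cell); so `o_B` is NOT producible from r06's `Reg335Cube`∕`Reg336Cube` data, and this file TYPES the minimal honest repair as a
MODEL datum: (3.35) with its next derivative.
* §1 (any complete normed ℂ-algebra with `‖1‖ = 1`) ★ `norm_pow_add_sub_pow_le` (`‖(x+h)ⁿ − xⁿ‖ ≤ (X+‖h‖)ⁿ − Xⁿ` for `‖x‖ ≤ X`), ★★ `norm_pow_mixedDiff_le`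
  (`‖(a+h+k)ⁿ − (a+h)ⁿ − (a+k)ⁿ + aⁿ‖ ≤` the same expression in `‖a‖, ‖h‖, ‖k‖` — the words containing at least one `h` and one `k`), ★★ `norm_exp_mixedDiff_le`
  (`‖e^{a+h+k} − e^{a+h} − e^{a+k} + e^a‖ ≤ ‖h‖‖k‖e^{‖a‖+‖h‖+‖k‖}`, termwise through the exponential series), ★★ `norm_exp_fourPoint_le` (four exponents of size `≤ s`:
  `‖e^{X₁₁} − e^{X₁₀} − e^{X₀₁} + e^{X₀₀}‖ ≤ (‖X₁₁ − X₁₀ − X₀₁ + X₀₀‖ + ‖X₁₀ − X₀₀‖·‖X₀₁ − X₀₀‖)·e^{5s}` — the parallelogram completion `X₁₀ + X₀₁ − X₀₀` and §1's two estimates).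
* §2 ★ `Reg335D2Cube T U η □ ξ C` — r06's `Reg335Cube` datum `(u, A)` («there exists a gauge transformation u on □ such that U^u = e^{iηA} … |A| < Cξ⁻¹, |∇^ηA| < Cξ⁻² on □») WITH THE
  NEXT FLAT DERIVATIVE `‖∇^η_κ′∇^η_κ A_ν‖ < Cξ⁻³` on □ (all `κ, κ′, ν`); `Reg335D2Cube.reg335Cube`; ★★ `secondLetter_of_gauge335D2` — for such a datum, at every `z` with
  `z, z+e_κ, z+e_κ′, z+e_κ+e_κ′ ∈ □`: `‖U^u_ν(z+e_κ+e_κ′) − U^u_ν(z+e_κ′) − U^u_ν(z+e_κ) + U^u_ν(z)‖ ≤ η³·((C∕ξ³) + η(C∕ξ²)²)·e^{5ηC∕ξ}` (§1 at `X = iηA_ν(·)`: the second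
  difference of the exponents is `iη·η²·∇∇A`, the two first differences are `iη·η·∇A`).
* §3 (`𝔸 = M_n(ℂ)`, operator norm) ★★★ `uN_exists_gauge_threeLetters_of_reg335D2Cube` — `Reg335D2Cube τ U η Q ξ C`, `η > 0` ⟹ ∃ `w` unitary EVERYWHERE (the datum's gauge on `Q`,
  `1` off `Q`, as n15-c∕346) with the pointwise letter `‖V_μ(z) − 1‖ ≤ η(C∕ξ)e^{ηC∕ξ}`, the all-direction step letter `‖V_μ(z+e_κ) − V_μ(z)‖ ≤ η²(C∕ξ²)e^{ηC∕ξ}` AND the third letter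
  `‖V_μ(z+e_κ+e_κ′) − V_μ(z+e_κ′) − V_μ(z+e_κ) + V_μ(z)‖ ≤ η³((C∕ξ³) + η(C∕ξ²)²)e^{5ηC∕ξ}` on the corresponding interiors of `Q` (`V_μ(z) = w(z)U_μ(z)w(z+e_μ)ᴴ`) — the input of
  n15-c∕357–358 (the divergence fit).  §4 `reg335D2Cube_one` (non-vacuity: `U ≡ 1` with `u ≡ 1`, `A ≡ 0`, any `ξ, C > 0`).

HONEST FRAMING ∕ LIMITS.  `Reg335D2Cube` is a MODEL regularity datum — (3.35) p. 396 as typed by r06 plus a flat second-derivative bound of (3.36)'s STRENGTH `Cξ⁻³` but on ALL second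
differences; [B9] does NOT print it ((3.36) bounds `∂^{η*}∂^ηA` only; (3.38) bounds `D*_UD_UA′` for the perturbation) and nothing here claims it follows from (3.35)–(3.36); its
production from the small-field conditions of the flow (node N04's business for (3.35)) is NOT claimed.  Exponential-series bookkeeping in a Banach algebra + r06's predicate
vocabulary; nothing of [B9] asserted.  NE2⁺ NOT PRINTED ∕ NOT proved; N15 of record untouched; K3⁸ OPEN; counts of record UNMOVED (typed 28∕28 · discharged 8∕27); one finite 𝕋⁴ at
fixed ε per index — NOT infinite volume, NOT OS on ℝ⁴, NOT a mass gap, NOT Clay.  Restate-immune (no Theses import).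
-/

set_option autoImplicit false

noncomputable section

open scoped BigOperators Matrix
open scoped Nat

/-! ## §1 The mixed second difference of powers and of `exp` in a Banach algebra -/

namespace Summit.QuantumFields.YangMills.BalabanUVNodes.N15.CurvedSpecies

section ExpEstimates

open NormedSpace

variable {𝔄 : Type*} [NormedRing 𝔄] [NormedAlgebra ℂ 𝔄] [CompleteSpace 𝔄] [NormOneClass 𝔄]

omit [NormedAlgebra ℂ 𝔄] [CompleteSpace 𝔄] in
/-- ★ FIRST DIFFERENCE OF POWERS WITH AN EXPLICIT MAJORANT: `‖(x + h)ⁿ − xⁿ‖ ≤ (X + ‖h‖)ⁿ − Xⁿ` whenever `‖x‖ ≤ X` (the words with at least one `h`; no commutativity). [folklore] -/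
theorem norm_pow_add_sub_pow_le (x h : 𝔄) {X : ℝ} (hX : ‖x‖ ≤ X) :
    ∀ n : ℕ, ‖(x + h) ^ n - x ^ n‖ ≤ (X + ‖h‖) ^ n - X ^ n := by
  have hX0 : 0 ≤ X := (norm_nonneg x).trans hX
  intro n
  induction n with
  | zero => simp
  | succ n ih =>
      have hid : (x + h) ^ (n + 1) - x ^ (n + 1) = ((x + h) ^ n - x ^ n) * (x + h) + x ^ n * h := by
        rw [pow_succ, pow_succ]; noncomm_ring
      have h0 : 0 ≤ (X + ‖h‖) ^ n - X ^ n := (norm_nonneg _).trans ih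
      have hxh : ‖x + h‖ ≤ X + ‖h‖ := (norm_add_le _ _).trans (add_le_add hX le_rfl)
      have hxn : ‖x ^ n‖ ≤ X ^ n := (norm_pow_le x n).trans (pow_le_pow_left₀ (norm_nonneg _) hX n)
      rw [hid]
      calc ‖((x + h) ^ n - x ^ n) * (x + h) + x ^ n * h‖ ≤ ‖((x + h) ^ n - x ^ n) * (x + h)‖ + ‖x ^ n * h‖ := norm_add_le _ _
        _ ≤ ((X + ‖h‖) ^ n - X ^ n) * (X + ‖h‖) + X ^ n * ‖h‖ :=
            add_le_add ((norm_mul_le _ _).trans (mul_le_mul ih hxh (norm_nonneg _) h0))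
              ((norm_mul_le _ _).trans (mul_le_mul_of_nonneg_right hxn (norm_nonneg _)))
        _ = (X + ‖h‖) ^ (n + 1) - X ^ (n + 1) := by ring

omit [NormedAlgebra ℂ 𝔄] [CompleteSpace 𝔄] in
/-- ★★ THE MIXED SECOND DIFFERENCE OF POWERS: `‖(a+h+k)ⁿ − (a+h)ⁿ − (a+k)ⁿ + aⁿ‖ ≤ (A+‖h‖+‖k‖)ⁿ − (A+‖h‖)ⁿ − (A+‖k‖)ⁿ + Aⁿ` for `‖a‖ ≤ A` — the non-commutative words of length `n`
in `a, h, k` containing at least one `h` AND at least one `k`, majorised word by word (induction: `P_{n+1} = P_n·a + D_n(a+h; k)·h + D_n(a+k; h)·k`). [folklore] -/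
theorem norm_pow_mixedDiff_le (a h k : 𝔄) {A : ℝ} (hA : ‖a‖ ≤ A) :
    ∀ n : ℕ, ‖(a + h + k) ^ n - (a + h) ^ n - (a + k) ^ n + a ^ n‖ ≤ (A + ‖h‖ + ‖k‖) ^ n - (A + ‖h‖) ^ n - (A + ‖k‖) ^ n + A ^ n := by
  have hA0 : 0 ≤ A := (norm_nonneg a).trans hA
  intro n
  induction n with
  | zero => simp
  | succ n ih =>
      have hid : (a + h + k) ^ (n + 1) - (a + h) ^ (n + 1) - (a + k) ^ (n + 1) + a ^ (n + 1) =
          ((a + h + k) ^ n - (a + h) ^ n - (a + k) ^ n + a ^ n) * a + ((a + h + k) ^ n - (a + h) ^ n) * h + ((a + k + h) ^ n - (a + k) ^ n) * k := by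
        rw [pow_succ, pow_succ, pow_succ, pow_succ, show a + k + h = a + h + k from add_right_comm a k h]
        simp only [sub_mul, add_mul, mul_add]
        abel
      have h0 : 0 ≤ (A + ‖h‖ + ‖k‖) ^ n - (A + ‖h‖) ^ n - (A + ‖k‖) ^ n + A ^ n := (norm_nonneg _).trans ih
      have hah : ‖a + h‖ ≤ A + ‖h‖ := (norm_add_le _ _).trans (add_le_add hA le_rfl)
      have hak : ‖a + k‖ ≤ A + ‖k‖ := (norm_add_le _ _).trans (add_le_add hA le_rfl)
      have h1 := norm_pow_add_sub_pow_le (a + h) k hah n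
      have h2 := norm_pow_add_sub_pow_le (a + k) h hak n
      rw [hid]
      calc ‖((a + h + k) ^ n - (a + h) ^ n - (a + k) ^ n + a ^ n) * a + ((a + h + k) ^ n - (a + h) ^ n) * h + ((a + k + h) ^ n - (a + k) ^ n) * k‖
          ≤ ‖((a + h + k) ^ n - (a + h) ^ n - (a + k) ^ n + a ^ n) * a‖ + ‖((a + h + k) ^ n - (a + h) ^ n) * h‖ + ‖((a + k + h) ^ n - (a + k) ^ n) * k‖ := norm_add₃_le
        _ ≤ ((A + ‖h‖ + ‖k‖) ^ n - (A + ‖h‖) ^ n - (A + ‖k‖) ^ n + A ^ n) * A + ((A + ‖h‖ + ‖k‖) ^ n - (A + ‖h‖) ^ n) * ‖h‖ + ((A + ‖k‖ + ‖h‖) ^ n - (A + ‖k‖) ^ n) * ‖k‖ := by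
            refine add_le_add (add_le_add ?_ ?_) ?_
            · exact (norm_mul_le _ _).trans (mul_le_mul ih hA (norm_nonneg _) h0)
            · exact (norm_mul_le _ _).trans (mul_le_mul_of_nonneg_right h1 (norm_nonneg _))
            · exact (norm_mul_le _ _).trans (mul_le_mul_of_nonneg_right h2 (norm_nonneg _))
        _ = (A + ‖h‖ + ‖k‖) ^ (n + 1) - (A + ‖h‖) ^ (n + 1) - (A + ‖k‖) ^ (n + 1) + A ^ (n + 1) := by ring

/-- ★★ THE MIXED SECOND DIFFERENCE OF THE EXPONENTIAL: `‖e^{a+h+k} − e^{a+h} − e^{a+k} + e^a‖ ≤ ‖h‖·‖k‖·e^{‖a‖+‖h‖+‖k‖}` in any Banach algebra — term by term through the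
exponential series by `norm_pow_mixedDiff_le`, the majorant summing to `e^A(e^H − 1)(e^K − 1) ≤ e^A·He^H·Ke^K`. [folklore] -/
theorem norm_exp_mixedDiff_le (a h k : 𝔄) : ‖exp (a + h + k) - exp (a + h) - exp (a + k) + exp a‖ ≤ ‖h‖ * ‖k‖ * Real.exp (‖a‖ + ‖h‖ + ‖k‖) := by
  set A : ℝ := ‖a‖ with hAdef
  set H : ℝ := ‖h‖ with hHdef
  set K : ℝ := ‖k‖ with hKdef
  -- two real facts: the exponential series `Σ tⁿ∕n! = eᵗ` and `eᵗ − 1 ≤ t·eᵗ` (from `1 − t ≤ e^{−t}`)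
  have hasSum_pow_div_factorial : ∀ t : ℝ, HasSum (fun n : ℕ => t ^ n / n !) (Real.exp t) := fun t => by
    have h := exp_series_hasSum_exp' (𝕂 := ℝ) t
    rw [← Real.exp_eq_exp_ℝ] at h
    simpa [smul_eq_mul, div_eq_inv_mul] using h
  have exp_sub_one_le_mul_exp : ∀ t : ℝ, Real.exp t - 1 ≤ t * Real.exp t := fun t => by
    have h1 : Real.exp t * (1 - t) ≤ 1 := by
      calc Real.exp t * (1 - t) ≤ Real.exp t * Real.exp (-t) := mul_le_mul_of_nonneg_left (by linarith [Real.add_one_le_exp (-t)]) (Real.exp_pos t).le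
        _ = 1 := by rw [← Real.exp_add, add_neg_cancel, Real.exp_zero]
    nlinarith [h1, Real.exp_pos t]
  -- the four series
  have e1 := exp_series_hasSum_exp' (𝕂 := ℂ) (a + h + k)
  have e2 := exp_series_hasSum_exp' (𝕂 := ℂ) (a + h)
  have e3 := exp_series_hasSum_exp' (𝕂 := ℂ) (a + k)
  have e4 := exp_series_hasSum_exp' (𝕂 := ℂ) a
  have hsum : HasSum (fun n : ℕ => ((n ! : ℂ)⁻¹) • ((a + h + k) ^ n - (a + h) ^ n - (a + k) ^ n + a ^ n))
      (exp (a + h + k) - exp (a + h) - exp (a + k) + exp a) := by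
    have hs := ((e1.sub e2).sub e3).add e4
    refine hs.congr_fun fun n => ?_
    simp only [smul_sub, smul_add]
  -- the real majorant series
  have r1 := hasSum_pow_div_factorial (A + H + K)
  have r2 := hasSum_pow_div_factorial (A + H)
  have r3 := hasSum_pow_div_factorial (A + K)
  have r4 := hasSum_pow_div_factorial A
  have rsum : HasSum (fun n : ℕ => ((A + H + K) ^ n - (A + H) ^ n - (A + K) ^ n + A ^ n) / n !)
      (Real.exp (A + H + K) - Real.exp (A + H) - Real.exp (A + K) + Real.exp A) := by
    have hs := ((r1.sub r2).sub r3).add r4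
    refine hs.congr_fun fun n => ?_
    ring
  have hle := hsum.norm_le_of_bounded rsum (fun n => by
    rw [norm_smul, norm_inv, Complex.norm_natCast, div_eq_inv_mul]
    exact mul_le_mul_of_nonneg_left (norm_pow_mixedDiff_le a h k le_rfl n) (by positivity))
  refine hle.trans ?_
  -- `e^A(e^H − 1)(e^K − 1) ≤ e^A·He^H·Ke^K`
  have hH0 : 0 ≤ H := norm_nonneg _
  have hK0 : 0 ≤ K := norm_nonneg _
  have hH1 := exp_sub_one_le_mul_exp H
  have hK1 := exp_sub_one_le_mul_exp K
  have hH2 : 0 ≤ Real.exp H - 1 := by linarith [Real.add_one_le_exp H]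
  have hK2 : 0 ≤ Real.exp K - 1 := by linarith [Real.add_one_le_exp K]
  have hfac : Real.exp (A + H + K) - Real.exp (A + H) - Real.exp (A + K) + Real.exp A = Real.exp A * ((Real.exp H - 1) * (Real.exp K - 1)) := by
    rw [Real.exp_add, Real.exp_add, Real.exp_add]; ring
  rw [hfac, show ‖h‖ * ‖k‖ * Real.exp (A + H + K) = Real.exp A * ((H * Real.exp H) * (K * Real.exp K)) by rw [Real.exp_add, Real.exp_add]; ring]
  exact mul_le_mul_of_nonneg_left (mul_le_mul hH1 hK1 hK2 ((hH2.trans hH1))) (Real.exp_pos A).le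

/-- ★★ THE FOUR-POINT SECOND DIFFERENCE OF EXPONENTIALS: for exponents of size `≤ s`,
`‖e^{X₁₁} − e^{X₁₀} − e^{X₀₁} + e^{X₀₀}‖ ≤ (‖X₁₁ − X₁₀ − X₀₁ + X₀₀‖ + ‖X₁₀ − X₀₀‖·‖X₀₁ − X₀₀‖)·e^{5s}` — through the parallelogram completion `X₁₀ + X₀₁ − X₀₀` (the Lipschitz
estimate of `exp` for the first summand, `norm_exp_mixedDiff_le` for the second). [folklore] -/
theorem norm_exp_fourPoint_le (X₀₀ X₁₀ X₀₁ X₁₁ : 𝔄) {s : ℝ} (h₀₀ : ‖X₀₀‖ ≤ s) (h₁₀ : ‖X₁₀‖ ≤ s) (h₀₁ : ‖X₀₁‖ ≤ s) (h₁₁ : ‖X₁₁‖ ≤ s) :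
    ‖exp X₁₁ - exp X₁₀ - exp X₀₁ + exp X₀₀‖ ≤ (‖X₁₁ - X₁₀ - X₀₁ + X₀₀‖ + ‖X₁₀ - X₀₀‖ * ‖X₀₁ - X₀₀‖) * Real.exp (5 * s) := by
  have hs : 0 ≤ s := (norm_nonneg _).trans h₀₀
  set a := X₀₀ with ha
  set p := X₁₀ - X₀₀ with hp
  set q := X₀₁ - X₀₀ with hq
  have hap : a + p = X₁₀ := by rw [hp]; abel
  have haq : a + q = X₀₁ := by rw [hq]; abel
  have hid : exp X₁₁ - exp X₁₀ - exp X₀₁ + exp X₀₀ = (exp X₁₁ - exp (a + p + q)) + (exp (a + p + q) - exp (a + p) - exp (a + q) + exp a) := by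
    rw [hap, haq]; abel
  have hpn : ‖p‖ ≤ 2 * s := by rw [hp]; exact (norm_sub_le _ _).trans (by linarith)
  have hqn : ‖q‖ ≤ 2 * s := by rw [hq]; exact (norm_sub_le _ _).trans (by linarith)
  have hd' : ‖a + p + q‖ ≤ 5 * s := (norm_add₃_le).trans (by linarith)
  have hdiff : X₁₁ - (a + p + q) = X₁₁ - X₁₀ - X₀₁ + X₀₀ := by rw [hp, hq]; abel
  -- first summand: Lipschitz
  have h1 : ‖exp X₁₁ - exp (a + p + q)‖ ≤ ‖X₁₁ - X₁₀ - X₀₁ + X₀₀‖ * Real.exp (5 * s) := by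
    refine (Literature.Analysis.Complex.norm_exp_sub_exp_le X₁₁ (a + p + q)).trans ?_
    rw [hdiff]
    exact mul_le_mul_of_nonneg_left (Real.exp_le_exp.mpr (max_le (h₁₁.trans (by linarith)) hd')) (norm_nonneg _)
  -- second summand: the mixed difference
  have h2 : ‖exp (a + p + q) - exp (a + p) - exp (a + q) + exp a‖ ≤ ‖p‖ * ‖q‖ * Real.exp (5 * s) := by
    refine (norm_exp_mixedDiff_le a p q).trans (mul_le_mul_of_nonneg_left (Real.exp_le_exp.mpr ?_) (by positivity))
    linarith
  rw [hid]
  calc _ ≤ ‖exp X₁₁ - exp (a + p + q)‖ + ‖exp (a + p + q) - exp (a + p) - exp (a + q) + exp a‖ := norm_add_le _ _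
    _ ≤ ‖X₁₁ - X₁₀ - X₀₁ + X₀₀‖ * Real.exp (5 * s) + ‖p‖ * ‖q‖ * Real.exp (5 * s) := add_le_add h1 h2
    _ = _ := by rw [hp, hq]; ring

end ExpEstimates

/-! ## §2 The MODEL datum «(3.35) one order up» on a cube and the third group letter in its gauge -/

section Generic

open NormedSpace
open Literature.MathematicalPhysics.QuantumFieldTheory.Balaban1983to89
open Literature.MathematicalPhysics.QuantumFieldTheory.Balaban1983to89.B9Eq39Adjoint (covD fluct)
open Literature.MathematicalPhysics.QuantumFieldTheory.Balaban1983to89.B9Eq3117Current (gaugeTr)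
open Literature.MathematicalPhysics.QuantumFieldTheory.Balaban1983to89.B9Eq335RegularityClasses (Reg335Cube norm_le_eta_mul_of_norm_inv_smul_lt)

variable {𝔸 : Type*} [NormedRing 𝔸] [NormedAlgebra ℂ 𝔸] [CompleteSpace 𝔸] [NormOneClass 𝔸] {S ι : Type*}
  (T : ι → Equiv.Perm S) (U : ι → S → 𝔸ˣ)

omit [NormOneClass 𝔸] in
/-- ★ **THE MODEL DATUM «(3.35) ONE ORDER UP» ON A CUBE** — r06's `Reg335Cube T U η □ ξ C` («there exists a gauge transformation u on □ such that U^u = e^{iηA} … |A| < Cξ⁻¹,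
|∇^ηA| < Cξ⁻² on □», flat `∇^η = η⁻¹D¹`) TOGETHER WITH the flat second derivative `‖∇^η_κ′∇^η_κA_ν‖ < Cξ⁻³` on □ for ALL `κ, κ′, ν`.  MODEL: [B9] prints the third bound only in the
form (3.36) `|∂^{η*}∂^ηA| < O(1)Mα₀(Lʲη)⁻³` (typed by r06 as `Reg336Cube`), which is weaker; nothing here claims this datum follows from (3.35)–(3.36).
[cite: Balaban1985BackgroundPropagators, (3.35)–(3.36) p.396 (the two printed orders and the strength `(Lʲη)⁻³` of the third: shape)] -/
def Reg335D2Cube (η : ℝ) (cube : Set S) (ξ C : ℝ) : Prop :=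
  ∃ (u : S → 𝔸ˣ) (A : ι → S → 𝔸),
    (∀ z ∈ cube, ‖(u z : 𝔸)‖ ≤ 1 ∧ ‖(((u z)⁻¹ : 𝔸ˣ) : 𝔸)‖ ≤ 1) ∧
    (∀ κ, ∀ z ∈ cube, gaugeTr T u U κ z = fluct η A κ z) ∧
    (∀ κ, ∀ z ∈ cube, ‖A κ z‖ < C * ξ⁻¹) ∧
    (∀ κ ν, ∀ z ∈ cube, ‖((η : ℂ)⁻¹) • covD T (fun _ _ => (1 : 𝔸ˣ)) κ (A ν) z‖ < C * (ξ ^ 2)⁻¹) ∧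
    (∀ κ κ' ν, ∀ z ∈ cube, ‖((η : ℂ)⁻¹) • covD T (fun _ _ => (1 : 𝔸ˣ)) κ' (fun w => ((η : ℂ)⁻¹) • covD T (fun _ _ => (1 : 𝔸ˣ)) κ (A ν) w) z‖ < C * (ξ ^ 3)⁻¹)

omit [NormOneClass 𝔸] in
/-- The MODEL datum contains r06's (3.35) datum on the cube. [cite: Balaban1985BackgroundPropagators, (3.35) p.396] -/
theorem Reg335D2Cube.reg335Cube {η : ℝ} {cube : Set S} {ξ C : ℝ} (h : Reg335D2Cube T U η cube ξ C) : Reg335Cube T U η cube ξ C := by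
  obtain ⟨u, A, hu, hg, hA, hD, -⟩ := h
  exact ⟨u, A, hu, hg, hA, hD⟩

omit [NormedAlgebra ℂ 𝔸] [CompleteSpace 𝔸] [NormOneClass 𝔸] in
/-- the iterated flat difference: `D¹_{1,κ′}(D¹_{1,κ}A_ν)(z) = A_ν(z+e_κ+e_κ′) − A_ν(z+e_κ′) − A_ν(z+e_κ) + A_ν(z)`. [cite: Balaban1985BackgroundPropagators, (3.3) p.391 (at `U = 1`)] -/
theorem covD_one_covD_one_apply (κ κ' : ι) (f : S → 𝔸) (z : S) :
    covD T (fun _ _ => (1 : 𝔸ˣ)) κ' (fun w => covD T (fun _ _ => (1 : 𝔸ˣ)) κ f w) z = f (T κ (T κ' z)) - f (T κ' z) - f (T κ z) + f z := by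
  rw [covD_one_apply', covD_one_apply', covD_one_apply']; abel

/-- ★★ **THE THIRD GROUP LETTER IN THE CUBE GAUGE** — for a gauge datum `(u, A)` with the clauses of `Reg335D2Cube` as binders (`u`, `A` free), `η > 0`: at every `z` with
`z, z+e_κ, z+e_κ′, z+e_κ+e_κ′ ∈ □`, `‖U^u_ν(z+e_κ+e_κ′) − U^u_ν(z+e_κ′) − U^u_ν(z+e_κ) + U^u_ν(z)‖ ≤ η³·((C∕ξ³) + η·(C∕ξ²)²)·e^{5ηC∕ξ}` (`U^u_ν = exp(iηA_ν)` at the four points;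
`norm_exp_fourPoint_le` with `s = ηC∕ξ`, the exponents' second difference `iη·D¹D¹A_ν = iη·η²·∇∇A_ν` and first differences `iη·D¹A_ν = iη·η·∇A_ν`).
[cite: Balaban1985BackgroundPropagators, (3.35)–(3.36) p.396 (shape), Cor. 3.6 p.408 («U′ = U^u = e^{iηA}»)] -/
theorem secondLetter_of_gauge335D2 {η : ℝ} (hη : 0 < η) {cube : Set S} {ξ C : ℝ} {u : S → 𝔸ˣ} {A : ι → S → 𝔸}
    (hg : ∀ κ, ∀ z ∈ cube, gaugeTr T u U κ z = fluct η A κ z) (hA : ∀ κ, ∀ z ∈ cube, ‖A κ z‖ < C * ξ⁻¹)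
    (hD : ∀ κ ν, ∀ z ∈ cube, ‖((η : ℂ)⁻¹) • covD T (fun _ _ => (1 : 𝔸ˣ)) κ (A ν) z‖ < C * (ξ ^ 2)⁻¹)
    (hDD : ∀ κ κ' ν, ∀ z ∈ cube, ‖((η : ℂ)⁻¹) • covD T (fun _ _ => (1 : 𝔸ˣ)) κ' (fun w => ((η : ℂ)⁻¹) • covD T (fun _ _ => (1 : 𝔸ˣ)) κ (A ν) w) z‖ < C * (ξ ^ 3)⁻¹)
    (κ κ' ν : ι) (z : S) (hz : z ∈ cube) (hzκ : T κ z ∈ cube) (hzκ' : T κ' z ∈ cube) (hzκκ' : T κ (T κ' z) ∈ cube) :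
    ‖(gaugeTr T u U ν (T κ (T κ' z)) : 𝔸) - gaugeTr T u U ν (T κ' z) - gaugeTr T u U ν (T κ z) + gaugeTr T u U ν z‖ ≤
      η ^ 3 * (((C / ξ ^ 3) + η * (C / ξ ^ 2) ^ 2) * Real.exp (5 * (η * (C / ξ)))) := by
  -- sizes of the exponents
  have hX : ∀ w ∈ cube, ‖(Complex.I * η : ℂ) • A ν w‖ ≤ η * (C / ξ) := fun w hw => by
    rw [norm_I_eta_smul hη.le]
    exact mul_le_mul_of_nonneg_left (by rw [div_eq_mul_inv]; exact (hA ν w hw).le) hη.le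
  have hval : ∀ w ∈ cube, (gaugeTr T u U ν w : 𝔸) = exp ((Complex.I * η : ℂ) • A ν w) := fun w hw => by rw [hg ν w hw, val_fluct]
  -- first differences
  have hd1 : ∀ ρ, ‖(Complex.I * η : ℂ) • A ν (T ρ z) - (Complex.I * η : ℂ) • A ν z‖ ≤ η * (η * (C * (ξ ^ 2)⁻¹)) := fun ρ => by
    rw [← smul_sub, ← covD_one_apply' T, norm_I_eta_smul hη.le]
    exact mul_le_mul_of_nonneg_left (norm_le_eta_mul_of_norm_inv_smul_lt hη (hD ρ ν z hz)) hη.le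
  -- the second difference
  have hd2 : ‖(Complex.I * η : ℂ) • A ν (T κ (T κ' z)) - (Complex.I * η : ℂ) • A ν (T κ' z) - (Complex.I * η : ℂ) • A ν (T κ z) + (Complex.I * η : ℂ) • A ν z‖ ≤
      η * (η ^ 2 * (C * (ξ ^ 3)⁻¹)) := by
    have e1 : (Complex.I * η : ℂ) • A ν (T κ (T κ' z)) - (Complex.I * η : ℂ) • A ν (T κ' z) - (Complex.I * η : ℂ) • A ν (T κ z) + (Complex.I * η : ℂ) • A ν z =
        (Complex.I * η : ℂ) • covD T (fun _ _ => (1 : 𝔸ˣ)) κ' (fun w => covD T (fun _ _ => (1 : 𝔸ˣ)) κ (A ν) w) z := by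
      rw [covD_one_covD_one_apply, smul_add, smul_sub, smul_sub]
    have e2 : covD T (fun _ _ => (1 : 𝔸ˣ)) κ' (fun w => ((η : ℂ)⁻¹) • covD T (fun _ _ => (1 : 𝔸ˣ)) κ (A ν) w) z =
        ((η : ℂ)⁻¹) • covD T (fun _ _ => (1 : 𝔸ˣ)) κ' (fun w => covD T (fun _ _ => (1 : 𝔸ˣ)) κ (A ν) w) z := by
      rw [covD_one_apply', covD_one_apply' T κ' (fun w => covD T (fun _ _ => (1 : 𝔸ˣ)) κ (A ν) w), smul_sub]
    have h3 := hDD κ κ' ν z hz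
    rw [e2] at h3
    have h5 := norm_le_eta_mul_of_norm_inv_smul_lt hη h3
    rw [norm_smul, norm_inv, Complex.norm_real, Real.norm_of_nonneg hη.le, inv_mul_le_iff₀ hη] at h5
    rw [e1, norm_I_eta_smul hη.le]
    calc η * ‖covD T (fun _ _ => (1 : 𝔸ˣ)) κ' (fun w => covD T (fun _ _ => (1 : 𝔸ˣ)) κ (A ν) w) z‖ ≤ η * (η * (η * (C * (ξ ^ 3)⁻¹))) := by gcongr
      _ = η * (η ^ 2 * (C * (ξ ^ 3)⁻¹)) := by ring
  rw [hval _ hzκκ', hval _ hzκ', hval _ hzκ, hval _ hz]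
  refine (norm_exp_fourPoint_le _ _ _ _ (hX z hz) (hX _ hzκ') (hX _ hzκ) (hX _ hzκκ')).trans ?_
  have hC3 : 0 ≤ η * (η ^ 2 * (C * (ξ ^ 3)⁻¹)) := (norm_nonneg _).trans hd2
  calc (‖(Complex.I * η : ℂ) • A ν (T κ (T κ' z)) - (Complex.I * η : ℂ) • A ν (T κ' z) - (Complex.I * η : ℂ) • A ν (T κ z) + (Complex.I * η : ℂ) • A ν z‖ +
          ‖(Complex.I * η : ℂ) • A ν (T κ' z) - (Complex.I * η : ℂ) • A ν z‖ * ‖(Complex.I * η : ℂ) • A ν (T κ z) - (Complex.I * η : ℂ) • A ν z‖) * Real.exp (5 * (η * (C / ξ)))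
      ≤ (η * (η ^ 2 * (C * (ξ ^ 3)⁻¹)) + (η * (η * (C * (ξ ^ 2)⁻¹))) * (η * (η * (C * (ξ ^ 2)⁻¹)))) * Real.exp (5 * (η * (C / ξ))) := by
        refine mul_le_mul_of_nonneg_right (add_le_add hd2 (mul_le_mul (hd1 κ') (hd1 κ) (norm_nonneg _) ((norm_nonneg _).trans (hd1 κ')))) (Real.exp_pos _).le
    _ = η ^ 3 * (((C / ξ ^ 3) + η * (C / ξ ^ 2) ^ 2) * Real.exp (5 * (η * (C / ξ)))) := by rw [div_eq_mul_inv, div_eq_mul_inv]; ring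

/-- ★★ (∃-form) the MODEL datum on a cube ⟹ a gauge of unitary type on □ with ALL THREE letters of the transformed bond variables: `‖U^u_κ − 1‖ ≤ η(C∕ξ)e^{ηC∕ξ}` on □,
`‖U^u_ν(z+e_κ) − U^u_ν(z)‖ ≤ η²(C∕ξ²)e^{ηC∕ξ}` (`z, z+e_κ ∈ □`), `‖U^u_ν(z+e_κ+e_κ′) − U^u_ν(z+e_κ′) − U^u_ν(z+e_κ) + U^u_ν(z)‖ ≤ η³((C∕ξ³) + η(C∕ξ²)²)e^{5ηC∕ξ}` (the four points in □).
[cite: Balaban1985BackgroundPropagators, (3.35)–(3.36) p.396 (shape), Cor. 3.6 p.408] -/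
theorem exists_gauge_threeLetters_of_reg335D2Cube {η : ℝ} (hη : 0 < η) {cube : Set S} {ξ C : ℝ} (h : Reg335D2Cube T U η cube ξ C) :
    ∃ u : S → 𝔸ˣ, (∀ z ∈ cube, ‖(u z : 𝔸)‖ ≤ 1 ∧ ‖(((u z)⁻¹ : 𝔸ˣ) : 𝔸)‖ ≤ 1) ∧
      (∀ κ, ∀ z ∈ cube, ‖(gaugeTr T u U κ z : 𝔸) - 1‖ ≤ η * (C / ξ) * Real.exp (η * (C / ξ))) ∧
      (∀ κ ν, ∀ z ∈ cube, T κ z ∈ cube → ‖(gaugeTr T u U ν (T κ z) : 𝔸) - gaugeTr T u U ν z‖ ≤ η ^ 2 * (C / ξ ^ 2) * Real.exp (η * (C / ξ))) ∧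
      (∀ κ κ' ν, ∀ z ∈ cube, T κ z ∈ cube → T κ' z ∈ cube → T κ (T κ' z) ∈ cube →
        ‖(gaugeTr T u U ν (T κ (T κ' z)) : 𝔸) - gaugeTr T u U ν (T κ' z) - gaugeTr T u U ν (T κ z) + gaugeTr T u U ν z‖ ≤
          η ^ 3 * (((C / ξ ^ 3) + η * (C / ξ ^ 2) ^ 2) * Real.exp (5 * (η * (C / ξ))))) := by
  obtain ⟨u, A, hu, hg, hA, hD, hDD⟩ := h
  obtain ⟨h1, h2⟩ := bondLetters_of_gauge335 T U hη hg hA hD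
  exact ⟨u, hu, h1, h2, fun κ κ' ν z hz hzκ hzκ' hzκκ' => secondLetter_of_gauge335D2 T U hη hg hA hD hDD κ κ' ν z hz hzκ hzκ' hzκκ'⟩

end Generic

/-! ## §3 `𝔸 = M_n(ℂ)` (operator norm): a gauge unitary everywhere with the three letters, from the MODEL datum on a set -/

section MatrixOp

open scoped Matrix.Norms.L2Operator
open Literature.MathematicalPhysics.QuantumFieldTheory.Balaban1983to89
open Literature.MathematicalPhysics.QuantumFieldTheory.Balaban1983to89.B9Eq39Adjoint (covD fluct)
open Literature.MathematicalPhysics.QuantumFieldTheory.Balaban1983to89.B9Eq3117Current (gaugeTr)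

variable {n : Type} [Fintype n] [DecidableEq n] [Nonempty n] {X J : Type} (τ : J → X ≃ X) (U : J → X → (Matrix n n ℂ)ˣ)

/-- ★★★ **FROM THE MODEL DATUM ON A SET: A GAUGE UNITARY EVERYWHERE WITH THE POINTWISE LETTER, THE ALL-DIRECTION STEP LETTER AND THE THIRD (SECOND-DIFFERENCE) LETTER OF THE
TRANSFORMED BOND VARIABLES** — `Reg335D2Cube τ U η Q ξ C` (`η > 0`) ⟹ ∃ `w`, `w(y)ᴴw(y) = 1` for all `y` (the datum's gauge on `Q`, `1` off `Q`, as n15-c∕346), with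
`V_μ(z) = w(z)U_μ(z)w(z+e_μ)ᴴ`: (i) `‖V_μ(z) − 1‖ ≤ η(C∕ξ)e^{ηC∕ξ}` for `z, z+e_μ ∈ Q`; (ii) `‖V_μ(z+e_κ) − V_μ(z)‖ ≤ η²(C∕ξ²)e^{ηC∕ξ}` for `z, z+e_κ, z+e_μ, z+e_κ+e_μ ∈ Q`;
(iii) `‖V_μ(z+e_κ+e_κ′) − V_μ(z+e_κ′) − V_μ(z+e_κ) + V_μ(z)‖ ≤ η³((C∕ξ³) + η(C∕ξ²)²)e^{5ηC∕ξ}` whenever the four base points and their `μ`-neighbours lie in `Q`.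
[cite: Balaban1985BackgroundPropagators, (3.35)–(3.36) p.396 (shape), Cor. 3.6 p.408] -/
theorem uN_exists_gauge_threeLetters_of_reg335D2Cube {η : ℝ} (hη : 0 < η) {Q : Set X} {ξ C : ℝ} (h : Reg335D2Cube τ U η Q ξ C) :
    ∃ w : X → Matrix n n ℂ, (∀ y, (w y)ᴴ * w y = 1) ∧
      (∀ μ z, z ∈ Q → τ μ z ∈ Q → ‖w z * (U μ z : Matrix n n ℂ) * (w (τ μ z))ᴴ - 1‖ ≤ η * ((C / ξ) * Real.exp (η * (C / ξ)))) ∧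
      (∀ κ μ z, z ∈ Q → τ κ z ∈ Q → τ μ z ∈ Q → τ μ (τ κ z) ∈ Q →
        ‖w (τ κ z) * (U μ (τ κ z) : Matrix n n ℂ) * (w (τ μ (τ κ z)))ᴴ - w z * (U μ z : Matrix n n ℂ) * (w (τ μ z))ᴴ‖ ≤ η ^ 2 * ((C / ξ ^ 2) * Real.exp (η * (C / ξ)))) ∧
      (∀ κ κ' μ z, z ∈ Q → τ κ z ∈ Q → τ κ' z ∈ Q → τ κ (τ κ' z) ∈ Q → τ μ z ∈ Q → τ μ (τ κ z) ∈ Q → τ μ (τ κ' z) ∈ Q → τ μ (τ κ (τ κ' z)) ∈ Q →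
        ‖w (τ κ (τ κ' z)) * (U μ (τ κ (τ κ' z)) : Matrix n n ℂ) * (w (τ μ (τ κ (τ κ' z))))ᴴ - w (τ κ' z) * (U μ (τ κ' z) : Matrix n n ℂ) * (w (τ μ (τ κ' z)))ᴴ -
            w (τ κ z) * (U μ (τ κ z) : Matrix n n ℂ) * (w (τ μ (τ κ z)))ᴴ + w z * (U μ z : Matrix n n ℂ) * (w (τ μ z))ᴴ‖ ≤
          η ^ 3 * (((C / ξ ^ 3) + η * (C / ξ ^ 2) ^ 2) * Real.exp (5 * (η * (C / ξ))))) := by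
  classical
  obtain ⟨u, A, hu1, hg, hA, hD, hDD⟩ := h
  obtain ⟨huQ, h1, h2⟩ := uN_opLetters_of_gauge335 (T := τ) U (cube := Q) hη hu1 hg hA hD
  have h3 := secondLetter_of_gauge335D2 (T := τ) U hη hg hA hD hDD
  refine ⟨Q.piecewise (fun z => (u z : Matrix n n ℂ)) (fun _ => 1), fun y => ?_, fun μ z hz hz' => ?_, fun κ μ z hz hzκ hzμ hzκμ => ?_,
    fun κ κ' μ z hz hzκ hzκ' hzκκ' hzμ hzκμ hzκ'μ hzκκ'μ => ?_⟩
  · by_cases hy : y ∈ Q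
    · rw [Set.piecewise_eq_of_mem _ _ _ hy]; exact Matrix.mem_unitaryGroup_iff'.mp (huQ y hy)
    · rw [Set.piecewise_eq_of_notMem _ _ _ hy, Matrix.conjTranspose_one, Matrix.mul_one]
  · rw [Set.piecewise_eq_of_mem _ _ _ hz, Set.piecewise_eq_of_mem _ _ _ hz', ← uN_val_gaugeTr_eq (T := τ) U (huQ (τ μ z) hz')]
    exact (h1 μ z hz).trans (le_of_eq (mul_assoc _ _ _))
  · rw [Set.piecewise_eq_of_mem _ _ _ hz, Set.piecewise_eq_of_mem _ _ _ hzκ, Set.piecewise_eq_of_mem _ _ _ hzμ, Set.piecewise_eq_of_mem _ _ _ hzκμ,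
      ← uN_val_gaugeTr_eq (T := τ) U (huQ (τ μ z) hzμ), ← uN_val_gaugeTr_eq (T := τ) U (huQ (τ μ (τ κ z)) hzκμ)]
    exact (h2 κ μ z hz hzκ).trans (le_of_eq (mul_assoc _ _ _))
  · rw [Set.piecewise_eq_of_mem _ _ _ hz, Set.piecewise_eq_of_mem _ _ _ hzκ, Set.piecewise_eq_of_mem _ _ _ hzκ', Set.piecewise_eq_of_mem _ _ _ hzκκ',
      Set.piecewise_eq_of_mem _ _ _ hzμ, Set.piecewise_eq_of_mem _ _ _ hzκμ, Set.piecewise_eq_of_mem _ _ _ hzκ'μ, Set.piecewise_eq_of_mem _ _ _ hzκκ'μ,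
      ← uN_val_gaugeTr_eq (T := τ) U (huQ (τ μ z) hzμ), ← uN_val_gaugeTr_eq (T := τ) U (huQ (τ μ (τ κ z)) hzκμ),
      ← uN_val_gaugeTr_eq (T := τ) U (huQ (τ μ (τ κ' z)) hzκ'μ), ← uN_val_gaugeTr_eq (T := τ) U (huQ (τ μ (τ κ (τ κ' z))) hzκκ'μ)]
    exact h3 κ κ' μ z hz hzκ hzκ' hzκκ'

/-! ## §4 Non-vacuity -/

/-- NON-VACUITY OF THE MODEL DATUM: the trivial background `U ≡ 1` with the trivial gauge `u ≡ 1` and `A ≡ 0` is in `Reg335D2Cube` on any set for all `ξ, C > 0` and every `η`.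
[cite: Balaban1985BackgroundPropagators, (3.35)–(3.36) p.396 (shape)] -/
theorem reg335D2Cube_one (η : ℝ) (Q : Set X) {ξ C : ℝ} (hξ : 0 < ξ) (hC : 0 < C) :
    Reg335D2Cube τ (fun (_ : J) (_ : X) => (1 : (Matrix n n ℂ)ˣ)) η Q ξ C := by
  refine ⟨fun _ => 1, fun _ _ => 0, fun z _ => ⟨?_, ?_⟩, fun κ z _ => ?_, fun κ z _ => ?_, fun κ ν z _ => ?_, fun κ κ' ν z _ => ?_⟩
  · rw [Units.val_one, norm_one]
  · rw [inv_one, Units.val_one, norm_one]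
  · rw [gaugeTr]
    apply Units.ext
    rw [val_fluct]
    simp
  · simp only [norm_zero]; positivity
  · simp only [covD_one_apply', sub_self, smul_zero, norm_zero]; positivity
  · simp only [covD_one_apply', sub_self, smul_zero, norm_zero]; positivity

end MatrixOp

end Summit.QuantumFields.YangMills.BalabanUVNodes.N15.CurvedSpecies

end
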